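import Summits.Ventures.HodgeRepro2.T5RecordSphericalSpectrumDatumFree
import Summits.Ventures.HodgeRepro2.T5RecordLatticeModelSeven

/-!
# Joint consistency at every unramified place that stays prime, for every CM field

Tier-5 support N3 / §G-N4.2 (seat p3, gen 87). Files 349 / 352 exhibit README §10.5 (ii)(d) for the lane — the
hypotheses of the lattice-model statement (file 331) and of the unramified-spectrum statement (file 344) inhabited AT
ONCE in one declaration — on the two toy fields at one inert place each. This file states the joint instantiation in
full generality: for EVERY CM field `K`, every place `vp` of `ℚ`, every place `v` of `K⁺` above it with
`disc K ∉ v` that stays prime in `K` (`v 𝓞_K = w`), and every algebraically closed `k` of characteristic `0`: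

* **`joint_outside_discriminant_of_staysPrime`** — (i) an additive character `ψ : ℚ_p → S¹` of conductor exponent `0`
  with `n(ψ ∘ Tr) = 0` exists, and for every such `ψ` and every `w' ∣ v`: `e = 1`, `n(ψ_{w'}) = 0`, `𝒪_{w'}` is
  `ψ_{w'}`-self-dual, `𝒪_{w'}³` is `ψ_{w'}`-self-dual for `diag(1, 1, −1)` under any integrality-preserving star and
  so is the split pair (file 331 for `M = diag(1, 1, −1)`); AND (ii) a datum `(θ, y)` and generators `l` exist with
  `u₀`, an isomorphism `Φ : U(J₃(u₀)) ≃* U(1 ⊗ H₀)` matching the hyperspecial subgroups, a star-fixed uniformiser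
  `ϖ'`, such that every irreducible `K_v`-finite representation of `U(1 ⊗ H₀)` with non-zero finite-dimensional
  `K_v`-invariants is `≅ (inertSphericalQuot (α · N(v)⁻²)) ∘ Φ⁻¹` for some `α ≠ 0` (file 355's hypothesis-free form
  of file 344).

The proof is the pair of files 331 (via file 348's `isUnit_det_diagonal`) and 355; nothing is re-proved. The toy
instances of files 349 / 352 are the cases `K = ℚ(ζ₇)`, `ℚ(i)` at `(3)`. §8(d): uses an L-value-free non-vanishing
device: NO.
-/

open Matrix NumberField NumberField.IsCMField IsDedekindDomain IsDedekindDomain.HeightOneSpectrum Module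
  MulAction
open scoped TensorProduct Pointwise
open Summit.Ventures.HodgeRepro2.T5UnitaryGroupForm Summit.Ventures.HodgeRepro2.T5UnitaryHeckeAdjoint
  Summit.Ventures.HodgeRepro2.T5HeckePermutationModule Summit.Ventures.HodgeRepro2.LevelPositivity
  Summit.Ventures.HodgeRepro2.T5LevelIdempotent Summit.Ventures.HodgeRepro2.T5StarOfInvolution
  Summit.Ventures.HodgeRepro2.T5FinitePlaceCM Summit.Ventures.HodgeRepro2.T5NonSplitPlaceUnitaryGroup
  Summit.Ventures.HodgeRepro2.T5RecordHyperspecial Summit.Ventures.HodgeRepro2.T5GlobalLatticeAlmostAll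
  Summit.Ventures.HodgeRepro2.T5HermitianThreeElements Summit.Ventures.HodgeRepro2.T5GaloisCartanThree
  Summit.Ventures.HodgeRepro2.T5InertDegreeGalois Summit.Ventures.HodgeRepro2.T5InertPlaceCompletion
  Summit.Ventures.HodgeRepro2.T5InertDegreeAdicCompletion Summit.Ventures.HodgeRepro2.T5InertSatakeTransform
  Summit.Ventures.HodgeRepro2.T5InertSatakeTransformCompletion Summit.Ventures.HodgeRepro2.T5InertUnipotentResidue
  Summit.Ventures.HodgeRepro2.T5InertSphericalSubquotient Summit.Ventures.HodgeRepro2.T5RecordSatakeCell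
  Summit.Ventures.HodgeRepro2.T5SplitPlaceUnitaryGroup Summit.Ventures.HodgeRepro2.T5FinitePlaceNormIndex
  Summit.Ventures.HodgeRepro2.T5HermitianLocalIsotropyN3 Summit.Ventures.HodgeRepro2.T5FinitePlaceSplitClassification
  Summit.Ventures.HodgeRepro2.T5InertDegreeCompletion Summit.Ventures.HodgeRepro2.T5InertPlaceCompletionCells
  Summit.Ventures.HodgeRepro2.T5RecordSatake Summit.Ventures.HodgeRepro2.T5CartanCellsDistinct
  Summit.Ventures.HodgeRepro2.T5RecordSatakeInert Summit.Ventures.HodgeRepro2.T5InertGlobalPrime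
  Summit.Ventures.HodgeRepro2.T5CMFieldSquareDatum Summit.Ventures.HodgeRepro2.T5RecordSatakeDegree
  Summit.Ventures.HodgeRepro2.T5RecordSatakeDegreeIntrinsic Summit.Ventures.HodgeRepro2.T5RecordSphericalSpectrum
  Summit.Ventures.HodgeRepro2.T5RecordSphericalSpectrumIntrinsic Summit.Ventures.HodgeRepro2.T5RecordSatakeToy
  Summit.Ventures.HodgeRepro2.T5RecordSphericalSpectrumDatumFree
  Summit.Ventures.HodgeRepro2.T5AdditiveConductor Summit.Ventures.HodgeRepro2.T5UnitaryGroupIsometry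
  Summit.Ventures.HodgeRepro2.T5ConductorDualLattice Summit.Ventures.HodgeRepro2.T5ConductorDualLatticeSplit
  Summit.Ventures.HodgeRepro2.T5SplitHermitianClass Summit.Ventures.HodgeRepro2.T5RecordLatticeModelOutsideDiscriminant
  Summit.Ventures.HodgeRepro2.T5RecordLatticeModelSeven

namespace Summit.Ventures.HodgeRepro2.T5RecordJointOutsideDiscriminant

universe uV

variable (K : Type*) [Field K] [NumberField K] [IsCMField K]
variable (vp : HeightOneSpectrum (𝓞 ℚ)) (v : HeightOneSpectrum (𝓞 (maximalRealSubfield K)))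
  [v.asIdeal.LiesOver vp.asIdeal] (h : ((discr K : ℤ) : 𝓞 (maximalRealSubfield K)) ∉ v.asIdeal)
variable (w : HeightOneSpectrum (𝓞 K)) [w.asIdeal.LiesOver v.asIdeal]
  (hmap : Ideal.map (algebraMap (𝓞 (maximalRealSubfield K)) (𝓞 K)) v.asIdeal = w.asIdeal)
variable (k : Type*) [Field k] [CharZero k] [IsAlgClosed k]

include h hmap in
/-- **JOINT CONSISTENCY AT EVERY UNRAMIFIED PLACE THAT STAYS PRIME, FOR EVERY CM FIELD** (README §10.5 (ii)(d) in full
generality): the lattice-model data of §N3.10.3 for `M = diag(1, 1, −1)` (file 331) AND the unramified spectrum of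
the record's pair `(U(1 ⊗ H₀), K_v)` with a datum and generators supplied (file 355), at the same place `v` of `K⁺`
over `vp`, with `disc K ∉ v` and `v 𝓞_K = w`, for any algebraically closed field `k` of characteristic `0`. -/
theorem joint_outside_discriminant_of_staysPrime :
      ((∃ ψ : AddChar (vp.adicCompletion ℚ) Circle, Continuous ψ ∧ (∃ y, ψ y ≠ 1) ∧
        conductorExp ψ (Valued.v : Valuation (vp.adicCompletion ℚ) (WithZero (Multiplicative ℤ))) = 0 ∧
        conductorExp (ψ.compAddMonoidHom
          (Algebra.trace (vp.adicCompletion ℚ) (v.adicCompletion (maximalRealSubfield K))).toAddMonoidHom)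
          (Valued.v : Valuation (v.adicCompletion (maximalRealSubfield K)) (WithZero (Multiplicative ℤ))) = 0) ∧
      ∀ (ψ : AddChar (vp.adicCompletion ℚ) Circle), Continuous ψ → (∃ y, ψ y ≠ 1) →
        conductorExp ψ (Valued.v : Valuation (vp.adicCompletion ℚ) (WithZero (Multiplicative ℤ))) = 0 →
        ∀ (w' : HeightOneSpectrum (𝓞 K)) [w'.asIdeal.LiesOver v.asIdeal],
          v.asIdeal.ramificationIdx' w'.asIdeal = 1 ∧
          conductorExp (recordChar K vp v w' ψ)
            (Valued.v : Valuation (w'.adicCompletion K) (WithZero (Multiplicative ℤ))) = 0 ∧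
          (∀ x : w'.adicCompletion K,
            (∀ y : w'.adicCompletion K, Valued.v y ≤ 1 → recordChar K vp v w' ψ (x * y) = 1) ↔ Valued.v x ≤ 1) ∧
          (∀ [StarRing (w'.adicCompletion K)],
            (∀ z : w'.adicCompletion K, IsLocalization.IsInteger (w'.adicCompletionIntegers K) z →
              IsLocalization.IsInteger (w'.adicCompletionIntegers K) (star z)) →
            ∀ x : Fin 3 → w'.adicCompletion K,
              (∀ y ∈ stdLattice (w'.adicCompletionIntegers K),
                recordChar K vp v w' ψ
                  (sesqForm (((algebraMap (𝓞 K) K).mapMatrix (Matrix.diagonal ![1, 1, -1])).map (algebraMap K (w'.adicCompletion K))) x y) = 1) ↔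
                x ∈ stdLattice (w'.adicCompletionIntegers K)) ∧
          (letI := swapStarRing (w'.adicCompletion K)
            ∀ x : Fin 3 → w'.adicCompletion K × w'.adicCompletion K,
              (∀ y : Fin 3 → w'.adicCompletion K × w'.adicCompletion K,
                (∀ i, Valued.v (y i).1 ≤ 1 ∧ Valued.v (y i).2 ≤ 1) →
                recordChar K vp v w' ψ
                    (sesqForm (pairMatrix (((algebraMap (𝓞 K) K).mapMatrix (Matrix.diagonal ![1, 1, -1])).map (algebraMap K (w'.adicCompletion K)))
                      (((algebraMap (𝓞 K) K).mapMatrix (Matrix.diagonal ![1, 1, -1])).map (algebraMap K (w'.adicCompletion K)))ᵀ) x y).1 *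
                  recordChar K vp v w' ψ
                    (sesqForm (pairMatrix (((algebraMap (𝓞 K) K).mapMatrix (Matrix.diagonal ![1, 1, -1])).map (algebraMap K (w'.adicCompletion K)))
                      (((algebraMap (𝓞 K) K).mapMatrix (Matrix.diagonal ![1, 1, -1])).map (algebraMap K (w'.adicCompletion K)))ᵀ) x y).2 = 1) ↔
                ∀ i, Valued.v (x i).1 ≤ 1 ∧ Valued.v (x i).2 ≤ 1)) ∧
      (∃ (θ : maximalRealSubfield K) (y : K) (hθ : algebraMap (maximalRealSubfield K) K θ = y ^ 2)
        (hy : complexConj K y ≠ y) (r : ℕ) (l : Fin r → 𝓞 K)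
        (_hl : Submodule.span (𝓞 (maximalRealSubfield K)) (Set.range l) = ⊤),
        letI := tensorStarRing K v
        letI := starRingOfQuadratic (finrank_eq_two K v w hθ hy (not_isSquare_of_staysPrime K v w hθ hy hmap))
          (localConj v w hθ.symm (span_pair_eq_top K hy) (not_isSquare_of_staysPrime K v w hθ hy hmap) (complexConj K))
          (localConj_ne_one v w hθ.symm (span_pair_eq_top K hy) (not_isSquare_of_staysPrime K v w hθ hy hmap)
            (complexConj K) (complexConj_apply_eq_neg K hθ hy))
        haveI := isDiscreteValuationRing_integralClosure_adicCompletion v w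
        haveI := finite_residueField_integralClosure_adicCompletion v w
        haveI : IsFractionRing (integralClosure (v.adicCompletionIntegers (maximalRealSubfield K)) (w.adicCompletion K))
          (w.adicCompletion K) :=
          integralClosure.isFractionRing_of_finite_extension (v.adicCompletion (maximalRealSubfield K))
            (w.adicCompletion K)
        ∃ (u₀ : (v.adicCompletionIntegers (maximalRealSubfield K))ˣ)
          (Φ : ↥(formUnitaryGroup (J3 (algebraMap (v.adicCompletionIntegers (maximalRealSubfield K))
            (w.adicCompletion K) (u₀ : v.adicCompletionIntegers (maximalRealSubfield K))))) ≃*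
            ↥(formUnitaryGroup (tensorGram K v (gramToy K))))
          (ϖ' : integralClosure (v.adicCompletionIntegers (maximalRealSubfield K)) (w.adicCompletion K))
          (hϖ' : Irreducible ϖ')
          (hs' : star (algebraMap (integralClosure (v.adicCompletionIntegers (maximalRealSubfield K))
            (w.adicCompletion K)) (w.adicCompletion K) ϖ') =
              algebraMap (integralClosure (v.adicCompletionIntegers (maximalRealSubfield K)) (w.adicCompletion K))
                (w.adicCompletion K) ϖ'),
          (∀ g, g ∈ hyperspecialSubgroup
              (integralClosure (v.adicCompletionIntegers (maximalRealSubfield K)) (w.adicCompletion K))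
              (J3 (algebraMap (v.adicCompletionIntegers (maximalRealSubfield K)) (w.adicCompletion K)
                (u₀ : v.adicCompletionIntegers (maximalRealSubfield K)))) ↔ Φ g ∈ recordHyperspecial K v l (gramToy K)) ∧
          ∀ {V : Type uV} [AddCommGroup V] [Module k V]
            (ρ : Representation k (↥(formUnitaryGroup (tensorGram K v (gramToy K)))) V) [ρ.IsIrreducible],
            KFinite ρ (recordHyperspecial K v l (gramToy K)) →
            ∀ [FiniteDimensional k (invariants ρ (recordHyperspecial K v l (gramToy K)))],
            invariants ρ (recordHyperspecial K v l (gramToy K)) ≠ ⊥ →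
            ∃ α : k, α ≠ 0 ∧ Nonempty (ρ.Equiv (comp Φ.symm
              (inertSphericalQuot
                (hstar_of_star_eq (localConj v w hθ.symm (span_pair_eq_top K hy)
                  (not_isSquare_of_staysPrime K v w hθ hy hmap) (complexConj K))
                  (fun x => by rw [star_p8_eq_star K v w hθ hy (not_isSquare_of_staysPrime K v w hθ hy hmap)]; rfl))
                (algebraMap (v.adicCompletionIntegers (maximalRealSubfield K)) (w.adicCompletion K)
                  (u₀ : v.adicCompletionIntegers (maximalRealSubfield K)))
                (star_algebraMap_of_star_eq (localConj v w hθ.symm (span_pair_eq_top K hy)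
                  (not_isSquare_of_staysPrime K v w hθ hy hmap) (complexConj K))
                  (fun x => by rw [star_p8_eq_star K v w hθ hy (not_isSquare_of_staysPrime K v w hθ hy hmap)]; rfl)
                  (u₀ : v.adicCompletionIntegers (maximalRealSubfield K)))
                (algebraMap_unit_ne_zero (F := v.adicCompletion (maximalRealSubfield K)) u₀)
                (isInteger_algebraMap (u₀ : v.adicCompletionIntegers (maximalRealSubfield K)))
                (isInteger_algebraMap_unit_inv u₀) hϖ' hs' k (α * ((Ideal.absNorm v.asIdeal : k) ^ 2)⁻¹))))) :=
  ⟨record_lattice_model_outside_discriminant K (Matrix.diagonal ![1, 1, -1]) (isUnit_det_diagonal K) v h vp,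
    exists_datum_generators_and_mulEquiv_forall_nonempty_equiv_inertSphericalQuot_record_gramToy_of_staysPrime K v w
      hmap k⟩

end Summit.Ventures.HodgeRepro2.T5RecordJointOutsideDiscriminant
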